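import Summits.CriticalPhenomena.Ising3DConformalLimit.Theses.HyperoctahedralRP
import Literature.Analysis.Complex.PeriodicEntireLiouville
import Literature.MathematicalPhysics.QuantumFieldTheory.OSLorentzInvariance
import Literature.MathematicalPhysics.QuantumFieldTheory.PointwiseOSReconstruction

/-!
# Line `bisector-cross-light-cone` — checked skeleton for crux `HyperoctahedralRP.LimitRotationInvariant`
# (item stmt-CriticalPhenomena-1980, route `HyperoctahedralRP`, rank 3) — opening crux-plan, 2026-08-16

Crux decl (concluded BY NAME by `LimitRotationInvariant_of` at the end of this file):
`Summit.CriticalPhenomena.Ising3DConformalLimit.Theses.HyperoctahedralRP.LimitRotationInvariant`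

    HRP2Rigidity → ∀ ρ Δ S, (H1) ρ > 0 on (0,1] → (H2) HasPointwiseScalingLimit (criticalCorr 3) ρ S →
      (H3) S = 0 off NonCoincident → (H4) IsNondegenerateTwoPoint S → (H5) IsTranslationInvariant S →
      (H6) IsScaleCovariant Δ S → IsRotationInvariant S.

## The line (card `Ideas/bisector-cross-light-cone.md`, triage r1 ×3 pass; merged with the panel's
## closing engine "boost entirety + O_h period π/2 + periodic Liouville")

THE LEVER (stubs 1–3).  In a coordinate plane of `ℤ³` the four lattice mirror normals
`{eᵢ, eⱼ, eᵢ+eⱼ, eᵢ−eⱼ}` (the `B₂` sub-arrangement of the nine `B₃` mirrors) are CLOSED UNDER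
BISECTION: the bisectors of `(eᵢ, eⱼ)` are `eᵢ ± eⱼ`, those of `(eᵢ+eⱼ, eᵢ−eⱼ)` are `eᵢ, eⱼ`.  For a
frame `(n, n')` of the plane with bisectors `b_± ∝ n ± n'`, reflection positivity of the limit `S` in
the mirror `n` makes the two-cluster functions `F(t,s) = Σ c_a d_b S(θ_n A_a ∪ (B_b + t n + s n'))`
matrix elements `⟪ψ, e^{-tH_n} e^{isP_{n'}} ψ'⟫` (energy–momentum pair of frame `n`; tree
`KernelEnergyMomentumPair`, `SemigroupJointSpectralMeasure`), while reflection positivity in the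
two BISECTOR mirrors makes `F`, in the light-cone coordinates `u = (t+s)/√2`, `v = (t−s)/√2`, the
restriction of BOUNDED holomorphic functions of `u` on a half-plane for every real `v` and of `v` for
every real `u`.  The bounded cross theorem (stub 2, Bernstein–Siciak–Zahariuta; for strips =
Cameron–Storvick's diamond; in tree as the Malgrange–Zerner `ℓ¹`-tube theorem
`Literature.Analysis.Complex.exists_holomorphic_extension_l1Tube`) then gives JOINT holomorphy on the
hull `{|arg(u−u₀)| + |arg(v−v₀)| < π/2}`, whose slice at fixed real `t` is the disc with diameter
`(−(t−√2u₀), t−√2v₀)` in `s`; the positive-definite `s ↦ F(t,s)` is therefore analytic in a disc of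
radius `t − C` about `0`, hence (Lukacs) in the strip `|Im s| < t − C` with `F(t, iβ) = ∫ e^{-tE-βp} dν ≤ M`;
letting `t → ∞` pins the joint spectral measure: `supp ν ⊂ {|p_{n'}| ≤ E_n}` — the SPEED-ONE IN-PLANE
LIGHT CONE (stub 3, `InPlaneCone`): the complex two-cluster translations
`(τ, σ) ↦ Σ c_a d_b S(θ_n A_a ∪ (B_b + τ n + σ n'))` are holomorphic and uniformly bounded on the tube
`{Re τ > |Im σ|}`.  No `(A)`, no scale covariance, no `Δ`-window: `B₃ ⊃ B₂` incidence + two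
classical theorems; and it correctly fails on the lattice (the real cross sets would be discrete).
Stub 1 supplies the frame data of the Ising limit in all nine lattice mirrors (RP transfer with the
disprover's rounding wrinkle, reflection/permutation invariance, continuity, Newman-type boundedness
of semigroup entries).

THE CLOSING (stubs 4–6).  Complex rotations `R_{θ+iη}` about the axis `e₂` displace points by
`i sinh η · J x` INSIDE the `(e₀,e₁)`-plane; in any in-plane lattice frame `n` the consecutive gaps of
the boosted configuration `R_{iη} X_θ` (`X_θ = R_θ X`, sorted by `n`-height) satisfy
`|Im Δσ| = |sinh η| Δh < cosh η Δh = Re Δτ` for EVERY `η` — speed exactly `1 = tanh ∞` is the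
threshold.  Hence (stub 5, Osterwalder–Schrader II Ch. V continuation with the contraction family
`N(τ,σ)` of stub 3 in place of `e^{-τH}`): for `X` in a dense set `𝒢_N` (no 45°-coincidences among
the plane projections of the points and of their differences, so that for every `θ` one of the four
in-plane frames sees `X_θ` with pairwise distinct non-zero heights) the orbit function
`ζ ↦ Φ_X(ζ) = S_N(R_ζ X)` is ENTIRE, `π/2`-PERIODIC (the quarter turn is in `O_h`, free for genuine
limits: tree `limit_signFlip`, `limit_coordPerm`), and by the Cauchy–Schwarz split at the axis mirror,
`|Φ_X(θ+iη)|² ≤ N_{θ_n L_θ}(η) · N_{U_θ}(η)` with `N_A(η) = ‖Ψ^ℂ[R_{iη}A]‖² = Φ_{θ_nA ∪ A}(iη)` the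
squared norm of a BOOSTED CLUSTER VECTOR.  Stub 4 — THE OPEN CORE of the whole crux, stated
method-agnostically — bounds these norms by `C e^{a|η|}` with `a < 4`, locally uniformly in the
cluster (routes: the `fourfold-carlson-boost` two-sided sandwich `‖e^{-uH}σ(0)e^{-vH}‖ ≲ u^{-Δ}+v^{-Δ}`
giving `a = 2Δ ≤ 2` when `Δ > 1/2`; scale covariance `R_{iη}x = cosh η (x + i tanh η Jx)` reduces it to
the growth of `S^ℂ` at the totally null degeneration `y ↦ y + iJy`; if the crux holds the truth is
`a = 0`).  Then the in-tree periodic Liouville theorem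
`Literature.Analysis.Complex.apply_eq_apply_of_periodic_of_norm_le_exp` (`T = π/2`, `aT < 2π ⟺ a < 4`)
makes `Φ_X` constant: `S_N(R_θ X) = S_N(X)` on `𝒢_N`; stub 6 (continuity of genuine limits is free,
tree `continuousOn_limit`; `O_h` conjugation gives the second axis; two axis circles conjugate every
plane reflection to a coordinate one; Cartan–Dieudonné `LinearIsometryEquiv.reflections_generate`)
upgrades this to `IsRotationInvariant S`.  The Δ-window enters only through stub 4 (`a < 4`), exactly
where the panel located it (r1-3 "calibration": spin ≥ 4 composites are RP in all directions and
anisotropic; `a = 2Δ+…` is where `Δ ≤ 1` is spent).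

## Registered stubs (the ONLY `sorry`s of this file)

| # | stub | content | size | status |
|---|---|---|---|---|
| 1 | `stub_latticeFrameData` | Ising limit ⇒ `Regular S` ∧ nine-mirror `FrameData` (RP transfer, O_h, E3, continuity, bounded semigroup entries) | M–L | provable now (tree: `criticalCorrNineMirrorRP_proof`, `limit_signFlip`, `limit_coordPerm`, `continuousOn_limit`, Newman) |
| 2 | `stub_diamondCross` | bounded cross theorem for two strips: separately holomorphic & bounded on `(ℝ×S_b) ∪ (S_b×ℝ)` ⇒ holomorphic & same bound on `{|Im z|+|Im w| < b}` | M | provable now (tree: `exists_holomorphic_extension_l1Tube`; or Hadamard three-lines + band-limited approximation) |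
| 3 | `stub_inPlaneLightCone` | THE LEVER: `DiamondCross` + frame data in `n, b₊, b₋` ⇒ `InPlaneCone S n n'` (model-independent) | L | provable now on paper (tree: `KernelEnergyMomentumPair`, `SemigroupJointSpectralMeasure`, `bochner_holds`, `frameIso`) |
| 4 | `stub_boostedNormGrowth` | OPEN CORE: growth `≤ C e^{a|η|}`, `a < 4`, of the continued doubled-cluster functions on `iℝ` | XL | open (sufficient: fourfold's `TwoSidedSigmaBound`, Δ > 1/2) |
| 5 | `stub_boostOrbitEntire` | cones + frame data + growth-`a` ⇒ for dense `X`: `ζ ↦ S_N(R_ζ X)` entire, `π/2`-periodic, type `a` | L–XL | provable on paper (OS II Ch. V with `N(τ,σ)`; tree `OSPoint*`, `SesquiHolomorphicPairing`, `PositiveKernelContinuation`) |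
| 6 | `stub_axisRotationsGenerate` | dense-set invariance under rotations about `e₂` ⇒ `IsRotationInvariant S` | M | provable now (tree: `continuousOn_limit`, `limit_signFlip/coordPerm`, `reflections_generate`) |

Composition (no `sorry` of its own): `LimitRotationInvariant_of_stubs` (the six statements as hypotheses)
and `LimitRotationInvariant_of : LimitRotationInvariant` (the six `stub_*` by name): stubs 1+2+3 ⇒ all
in-plane cones; stub 4 ⇒ `a < 4`;
stub 5 ⇒ entire periodic orbit functions of type `a`; periodic Liouville (tree) ⇒ constant ⇒ axis
invariance on dense sets; stub 6 ⇒ the crux.  `HRP2Rigidity` (the crux's antecedent, closed by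
`XRayMellin.HRP2Rigidity_of`) is handed to stubs 4 and 5 (round `S₂`: explicit one-spin sector).

## Disproof used (`Cruxes/LimitRotationInvariant/Disproof.lean`, cdisprove cycle 1 — the file is not
## mounted on this hub; read through its four evidence notes on the item, 2026-08-15T22:38Z–22:57Z)

* `cruxBody_false_without_scalingLimit` (H2 load-bearing; witness `W` with round `W₂`, cubic `W₄`):
  H2 is consumed by stub 1 (nine-mirror RP of the LIMIT is transferred from the lattice,
  `CriticalCorrNineMirrorRP`; `W` is not RP, `witness_not_reflectionPositiveAlong`) and by stubs 5/6
  (free `O_h` invariance and continuity of genuine limits).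
* `not_modelBlindNPointUpgrade` (Δ-window + B₃ + E3 + continuity + round S₂ do NOT give the upgrade):
  honoured — the line's non-blind input is RP of the limit in the nine mirrors AT ALL ORDERS (stubs 3–5),
  which `W` violates (`W₆ ≡ 0 ≢ W₄`).
* `cruxBody_false_without_normalisation`: H3 is used in stub 1 (`Regular`), stub 4 (`K ⊆ NonCoincident`)
  and stub 6 (coincident configurations are fixed by the conclusion trivially).
* free lemmas `isTranslationInvariant_of_limit`, `isPermutationSymmetric_of_limit`,
  `isHyperoctahedralInvariant_of_limit`, `limit_odd_eq_zero`: re-derived inside stub 1 / stub 5 from the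
  tree's `MoebiusLimitExists/Negative/{FreeTranslations,FreePermutations,FreeReflections}`.
* rounding wrinkle (`⌊−t⌋ = −⌊t⌋ − 1`): stub 1 transfers RP along the commensurable meshes
  `δ = 1/(q m)` at rational configurations (where rounding commutes with all nine reflections exactly)
  and extends by the free continuity — exactly the disprover's prescription.
* No `-- Targets` stub kill applies; no `Theorems/LimitRotationInvariant/Negative/` lemma exists yet.
-/

noncomputable section

open scoped BigOperators InnerProductSpace
open Complex Literature.Probability.LatticeModels
open Summit.CriticalPhenomena.Ising3DConformalLimit.Theses.HyperoctahedralRP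

namespace Summit.CriticalPhenomena.Ising3DConformalLimit.Cruxes.LimitRotationInvariant.BisectorCrossLightCone

/-- Points of `ℝ³`. -/
local notation "E3" => EuclideanSpace ℝ (Fin 3)

/-! ## §0 Vocabulary (abbreviations over tree declarations; every stub unfolds to tree terms) -/

/-- The unit coordinate vector `eᵢ`. [folklore] -/
abbrev e (i : Fin 3) : E3 := EuclideanSpace.single i (1 : ℝ)

/-- The mirror reflection `θ_v` in the plane `v^⊥` through the origin (Mathlib `Submodule.reflection`,
as in `HRP2Rigidity`). [folklore] -/
abbrev refl (v : E3) (x : E3) : E3 := ((ℝ ∙ v)ᗮ).reflection x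

/-- The rotation of `ℝ³` about the axis `e₂` by the angle `θ` (the tree's Euclidean plane rotation
`planeRot` in the `(0,1)`-plane: `x₀ ↦ cos θ x₀ + sin θ x₁`, `x₁ ↦ −sin θ x₀ + cos θ x₁`, `x₂ ↦ x₂`). [folklore] -/
abbrev rot (θ : ℝ) : E3 ≃ₗᵢ[ℝ] E3 :=
  Literature.MathematicalPhysics.QuantumFieldTheory.planeRot (d := 2) 0 θ

/-- The hypotheses of the crux on a candidate limit `(ρ, Δ, S)`, verbatim. -/
def CruxHyp (ρ : ℝ → ℝ) (Δ : ℝ) (S : CorrFamily 3) : Prop :=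
  (∀ δ ∈ Set.Ioc (0:ℝ) 1, 0 < ρ δ) ∧ HasPointwiseScalingLimit (criticalCorr 3) ρ S ∧
  (∀ n z, z ∉ NonCoincident 3 n → S n z = 0) ∧ IsNondegenerateTwoPoint S ∧
  IsTranslationInvariant S ∧ IsScaleCovariant Δ S

/-- The nine lattice mirror normals of `ℤ³` (the `B₃` arrangement), written exactly as in
`HRP2Rigidity`: `eᵢ`, `eᵢ + eⱼ`, `eᵢ − eⱼ` (`i ≠ j`). [folklore] -/
def IsLatticeMirrorNormal (v : E3) : Prop :=
  ∃ i j : Fin 3, i ≠ j ∧ (v = e i ∨ v = e i + e j ∨ v = e i - e j)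

/-- The reflection-positivity GRAM PAIRING across the mirror `v^⊥` between two finite real formal
combinations of finite configurations — `Σ_a c_a δ[x^a]` and `Σ_b d_b δ[y^b]` — with the second one
translated by `w`:  `Σ_{a,b} c_a d_b S(θ_v x^a ∪ (y^b + w))`.  For `w = 0` and `y = x`, `d = c` this is
the quadratic form of `CriticalCorrNineMirrorRP`; for `w = t v + s v'` it is the two-cluster function
`⟪ψ, e^{-t|v|H_v} e^{is|v'|P_{v'}} ψ'⟫` of the Osterwalder–Schrader picture of frame `v`. [folklore] -/
def rpSum (S : CorrFamily 3) (v : E3) {m : ℕ} (k : Fin m → ℕ) (x : (a : Fin m) → Fin (k a) → E3)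
    (c : Fin m → ℝ) {m' : ℕ} (k' : Fin m' → ℕ) (y : (b : Fin m') → Fin (k' b) → E3)
    (d : Fin m' → ℝ) (w : E3) : ℝ :=
  ∑ a, ∑ b, c a * d b * S (k a + k' b) (Fin.append (fun i => refl v (x a i)) (fun j => y b j + w))

/-- Reflection positivity of `S` in the mirror `v^⊥`: the Gram pairing of every finite real formal
combination of configurations strictly inside the open half-space `{⟪·,v⟫ > 0}` with itself is `≥ 0`
(the continuum form of `CriticalCorrNineMirrorRP`; Fröhlich–Israel–Lieb–Simon 1978 §3; Glimm–Jaffe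
(6.1.8)–(6.1.11)). [folklore] -/
def MirrorRP (S : CorrFamily 3) (v : E3) : Prop :=
  ∀ (m : ℕ) (k : Fin m → ℕ) (x : (a : Fin m) → Fin (k a) → E3) (c : Fin m → ℝ),
    (∀ a i, 0 < inner ℝ (x a i) v) → 0 ≤ rpSum S v k x c k x c 0

/-- OSTERWALDER–SCHRADER FRAME DATA of `S` for the mirror normal `v`: `θ_v`-invariance, reflection
positivity, and boundedness of the diagonal semigroup entries `t ↦ ⟪ψ, e^{-tH_v}ψ⟫` on the span of
configuration vectors (the pointwise substitute for the temperedness bound OS (4.8) that makes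
`e^{-tH_v}` a contraction; Glimm–Jaffe Thm. 6.1.3). [folklore] -/
def FrameData (S : CorrFamily 3) (v : E3) : Prop :=
  (∀ (n : ℕ) (z : Fin n → E3), S n (fun i => refl v (z i)) = S n z) ∧
  MirrorRP S v ∧
  (∀ (m : ℕ) (k : Fin m → ℕ) (x : (a : Fin m) → Fin (k a) → E3) (c : Fin m → ℝ),
    (∀ a i, 0 < inner ℝ (x a i) v) → ∃ M : ℝ, ∀ t : ℝ, 0 ≤ t → |rpSum S v k x c k x c (t • v)| ≤ M)

/-- Model-independent regularity of a correlation family: translation invariance, continuity off the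
diagonals, normalisation `S = 0` on coincident configurations, permutation symmetry (E3). [folklore] -/
def Regular (S : CorrFamily 3) : Prop :=
  IsTranslationInvariant S ∧ (∀ n, ContinuousOn (S n) (NonCoincident 3 n)) ∧
  (∀ n z, z ∉ NonCoincident 3 n → S n z = 0) ∧
  Literature.MathematicalPhysics.QuantumFieldTheory.IsPermutationSymmetric S

/-- A `B₂` FRAME of a coordinate plane: an orthogonal pair `(n, n')` of coplanar lattice mirror
normals of equal length together with its two BISECTOR mirrors `b₊ ∥ n + n'`, `b₋ ∥ n − n'`, which are
again lattice mirrors — the incidence that exists exactly for the `B₂` sub-arrangement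
`{eᵢ, eⱼ, eᵢ+eⱼ, eᵢ−eⱼ}` of `B₃` (all three shapes, both orders). [folklore] -/
def IsB2Frame (n n' bp bm : E3) : Prop :=
  ∃ i j : Fin 3, i ≠ j ∧
    ((n = e i ∧ n' = e j ∧ bp = e i + e j ∧ bm = e i - e j) ∨
     (n = e i + e j ∧ n' = e i - e j ∧ bp = e i ∧ bm = e j) ∨
     (n = e i - e j ∧ n' = e i + e j ∧ bp = e i ∧ bm = e j))

/-- THE SPEED-ONE IN-PLANE LIGHT CONE of `S` in the frame `(n, n')` (`|n| = |n'|`, `n ⊥ n'`), in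
elementary form: for any two finite real formal combinations of configurations strictly inside
`{⟪·,n⟫ > 0}`, the two-cluster function `(t, s) ↦ Σ c_a d_b S(θ_n x^a ∪ (y^b + t n + s n'))`
(`t > 0`, `s ∈ ℝ`) is the restriction of ONE function holomorphic on the tube `{Re τ > |Im σ|}` and
bounded there by the sum of the two squared OS norms.  Equivalently `Spec(H_n, P_{n'}) ⊂ {|p| ≤ E}`:
the complex translations `e^{-τ|n|H_n + iσ|n|P_{n'}}` are holomorphic contractions on the tube
(Glimm–Jaffe Cor. 19.5.4 derives this FROM rotation invariance; here it is an INPUT to rotations). -/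
def InPlaneCone (S : CorrFamily 3) (n n' : E3) : Prop :=
  ∀ (m : ℕ) (k : Fin m → ℕ) (x : (a : Fin m) → Fin (k a) → E3) (c : Fin m → ℝ)
    (m' : ℕ) (k' : Fin m' → ℕ) (y : (b : Fin m') → Fin (k' b) → E3) (d : Fin m' → ℝ),
    (∀ a i, 0 < inner ℝ (x a i) n) → (∀ b j, 0 < inner ℝ (y b j) n) →
    ∃ G : ℂ × ℂ → ℂ, DifferentiableOn ℂ G {p : ℂ × ℂ | |p.2.im| < p.1.re} ∧
      (∀ p : ℂ × ℂ, |p.2.im| < p.1.re → ‖G p‖ ≤ rpSum S n k x c k x c 0 + rpSum S n k' y d k' y d 0) ∧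
      ∀ t s : ℝ, 0 < t → G ((t : ℂ), (s : ℂ)) = rpSum S n k x c k' y d (t • n + s • n')

/-- All four in-plane cones of every coordinate plane (both orders of each `B₂` pair). -/
def AllCones (S : CorrFamily 3) : Prop :=
  ∀ n n' bp bm : E3, IsB2Frame n n' bp bm → InPlaneCone S n n'

/-- THE BOUNDED CROSS THEOREM FOR TWO STRIPS (Bernstein 1912 / Siciak 1969 / Zahariuta 1976 with the
relative extremal function `h_{ℝ,S_b}(z) = |Im z|/b`; for strips: Cameron–Storvick 1966): a function
`F` of two real variables which for every real `y` is the restriction of a function holomorphic and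
bounded by `M` on the strip `|Im z| < b`, and for every real `x` likewise in the second variable, is
the restriction of ONE function holomorphic on the DIAMOND TUBE `{|Im z| + |Im w| < b}` and bounded by
`M` there (sharp maximum principle `sup_X̂ |F̂| = sup_X |F|`).  Joint continuity of `F` is automatic
(normal families).  In tree in tempered form: `Literature.Analysis.Complex.exists_holomorphic_extension_l1Tube`
(Malgrange–Zerner, the convex hull of the two flat tubes is the diamond). [folklore] -/
def DiamondCross : Prop :=
  ∀ (b M : ℝ) (F : ℝ → ℝ → ℂ), 0 < b →
    (∀ y : ℝ, ∃ g : ℂ → ℂ, DifferentiableOn ℂ g {z : ℂ | |z.im| < b} ∧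
      (∀ z : ℂ, |z.im| < b → ‖g z‖ ≤ M) ∧ ∀ x : ℝ, g x = F x y) →
    (∀ x : ℝ, ∃ h : ℂ → ℂ, DifferentiableOn ℂ h {w : ℂ | |w.im| < b} ∧
      (∀ w : ℂ, |w.im| < b → ‖h w‖ ≤ M) ∧ ∀ y : ℝ, h y = F x y) →
    ∃ G : ℂ × ℂ → ℂ, DifferentiableOn ℂ G {p : ℂ × ℂ | |p.1.im| + |p.2.im| < b} ∧
      (∀ p : ℂ × ℂ, |p.1.im| + |p.2.im| < b → ‖G p‖ ≤ M) ∧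
      ∀ x y : ℝ, G ((x : ℂ), (y : ℂ)) = F x y

/-- The four in-plane lattice mirror normals of the `(e₀,e₁)`-plane (the frames available for complex
rotations about `e₂`). [folklore] -/
def InPlaneNormal (n : E3) : Prop := n = e 0 ∨ n = e 1 ∨ n = e 0 + e 1 ∨ n = e 0 - e 1

/-- The `θ_v`-doubled configuration `θ_v A ∪ A` of a cluster `A` (its value under `S` is the squared
OS norm `‖Ψ_A‖²_v`). [folklore] -/
def doubled (v : E3) {m : ℕ} (A : Fin m → E3) : Fin (m + m) → E3 :=
  Fin.append (fun i => refl v (A i)) A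

/-- BOOSTED-CLUSTER NORM GROWTH of exponential type `a` (the quantity bounded by the open core, stub 4):
for each in-plane frame `n` and each compact family `K` of non-coincident clusters strictly inside
`{⟪·,n⟫ > 0}` there is ONE constant `C` such that for every `A ∈ K`, every local holomorphic extension
`g` of the real rotation orbit `θ ↦ S_{2m}(R_θ(θ_n A ∪ A))` (rotation about `e₂`, `|θ| < ε`) to the
vertical strip `|Re ζ| < ε` satisfies `‖g(iη)‖ ≤ C e^{a|η|}` for all real `η`.  (By the identity theorem
`g` is unique; on `iℝ` it is the squared norm `‖Ψ^ℂ[R_{iη}A]‖²` of the boosted cluster vector.  If the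
crux holds, `g(iη) = S_{2m}(θ_nA ∪ A)` and `a = 0` works.) -/
def BoostedNormGrowth (S : CorrFamily 3) (a : ℝ) : Prop :=
  ∀ n : E3, InPlaneNormal n → ∀ (m : ℕ) (K : Set (Fin m → E3)), IsCompact K →
    K ⊆ {A | A ∈ NonCoincident 3 m ∧ ∀ i, 0 < inner ℝ (A i) n} →
    ∃ C : ℝ, ∀ A ∈ K, ∀ ε : ℝ, 0 < ε → ∀ g : ℂ → ℂ,
      DifferentiableOn ℂ g {ζ : ℂ | |ζ.re| < ε} →
      (∀ θ : ℝ, |θ| < ε → g θ = S (m + m) (fun i => rot θ (doubled n A i))) →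
      ∀ η : ℝ, ‖g (η * I)‖ ≤ C * Real.exp (a * |η|)

/-! ## §1 The six registered stubs (the ONLY `sorry`s of this file) and their statements -/

/-- Statement of stub 1. -/
def LatticeFrameDataStmt : Prop :=
  ∀ (ρ : ℝ → ℝ) (Δ : ℝ) (S : CorrFamily 3), CruxHyp ρ Δ S →
    Regular S ∧ ∀ v : E3, IsLatticeMirrorNormal v → FrameData S v

/-- **Stub 1 — lattice-to-continuum transfer of the OS frame data (provable now, M–L).**  Every
normalised pointwise scaling limit `S` of `criticalCorr 3` as in the crux is `Regular` (translation
invariance is a hypothesis; continuity off the diagonals, permutation symmetry and normalisation are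
free: tree `MoebiusLimitExists/Negative/MeshContinuity.continuousOn_limit`, symmetry of spin monomials)
and carries `FrameData` in each of the nine lattice mirrors: `θ_v`-invariance (signed permutations,
tree `limit_signFlip`, `limit_coordPerm`, plus normalisation on the coincident locus); `MirrorRP S v`
from the landed `CriticalCorrNineMirrorRP` (`HyperoctahedralRPNineMirror.criticalCorrNineMirrorRP_proof`)
along the commensurable meshes `δ = 1/(qm)` at rational configurations (there `⌊·/δ⌋` commutes with all
nine reflections and strict positivity `ℓ > 0` is exact; non-injective `x^a` contribute `0` on both
sides after dropping them), extended to all configurations by the free continuity; boundedness of the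
semigroup entries from Newman's Gaussian inequality for the limit (`newman_evenMoment_le` passes to
pointwise limits) and the two-point decay `S₂(0,x) ≤ C‖x‖^{-2Δ}` (`TwoPointKernelOfLimit`, landed).
Honours `cruxBody_false_without_scalingLimit` (H2 is used here) and the disprover's rounding wrinkle. -/
theorem stub_latticeFrameData :
    ∀ (ρ : ℝ → ℝ) (Δ : ℝ) (S : CorrFamily 3), CruxHyp ρ Δ S →
      Regular S ∧ ∀ v : E3, IsLatticeMirrorNormal v → FrameData S v := by
  sorry

/-- **Stub 2 — the bounded cross theorem for two strips (provable now, M).**  Pure one/two-variable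
complex analysis, TRUE classically (Siciak–Zahariuta cross theorem with `h_{ℝ,S_b} = |Im|/b`;
Jarnicki–Pflug, *Extension of Holomorphic Functions* (2011/2020), cross theorem with pluriregular
sets; Cameron–Storvick, Trans. AMS 125 (1966)).  Lean routes: (i) the tree's tempered flat-tube
theorem `Literature.Analysis.Complex.exists_holomorphic_extension_l1Tube` (`k = 2`) applied to the
functional `T(ϑ₁,ϑ₂) = ∬ F ϑ₁ ϑ₂` (slot holomorphy by dominated parameter integrals; `F` is jointly
continuous by normal families; pointwise values recovered by continuity), sharp bound by the `1/(F−c)`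
trick as in `BochnerTubeFourier`; or (ii) directly: approximate `F(z,·)` by the entire functions
`F_k(z,w) = ∫ F(z,y) V_k(w−y) dy` (de la Vallée-Poussin kernels of type `k`, built from REAL-LINE
values, hence holomorphic in `z`), error `≲ M e^{-(b−|Im w|)k}` on `z ∈ ℝ`, size `≲ M e^{k|Im w|}` on
the strip, and interpolate with Hadamard's three-lines theorem (Mathlib
`Complex.HadamardThreeLines`) in `z`: the series converges exactly where `|Im z| + |Im w| < b`. -/
theorem stub_diamondCross :
    ∀ (b M : ℝ) (F : ℝ → ℝ → ℂ), 0 < b →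
      (∀ y : ℝ, ∃ g : ℂ → ℂ, DifferentiableOn ℂ g {z : ℂ | |z.im| < b} ∧
        (∀ z : ℂ, |z.im| < b → ‖g z‖ ≤ M) ∧ ∀ x : ℝ, g x = F x y) →
      (∀ x : ℝ, ∃ h : ℂ → ℂ, DifferentiableOn ℂ h {w : ℂ | |w.im| < b} ∧
        (∀ w : ℂ, |w.im| < b → ‖h w‖ ≤ M) ∧ ∀ y : ℝ, h y = F x y) →
      ∃ G : ℂ × ℂ → ℂ, DifferentiableOn ℂ G {p : ℂ × ℂ | |p.1.im| + |p.2.im| < b} ∧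
        (∀ p : ℂ × ℂ, |p.1.im| + |p.2.im| < b → ‖G p‖ ≤ M) ∧
        ∀ x y : ℝ, G ((x : ℂ), (y : ℂ)) = F x y := by
  sorry

/-- Statement of stub 3 (THE LEVER, model-independent). -/
def InPlaneLightConeStmt : Prop :=
  DiamondCross → ∀ (S : CorrFamily 3) (n n' bp bm : E3), IsB2Frame n n' bp bm → Regular S →
    FrameData S n → FrameData S bp → FrameData S bm → InPlaneCone S n n'

/-- **Stub 3 — the bisector cross gives the in-plane light cone (the card's lever; L; provable on
paper, every ingredient in tree).**  For a `Regular` family with OS frame data in the mirror `n` and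
in its two bisector mirrors `b₊, b₋` of the `B₂` frame `(n, n')`:
(1) frame `n`: GNS on the kernel `S(θ_n x^a ∪ y^b)` over configurations in `{⟪·,n⟫>0}` (Mathlib
`RKHS`, tree `KernelEnergyMomentumPair`: relabelling semigroup `y ↦ y + t n` is kernel-symmetric with
bounded entries ⇒ contraction `e^{-t|n|H}` by the OS iteration; `y ↦ y + s n'` kernel-preserving ⇒
unitary; strong continuity from continuity of entries; tree `frameIso` turns `n` into the time axis),
so `exists_isEnergyMomentumPair` + `SemigroupJointSpectralMeasure` give, for every `ψ` in the span, a
finite positive measure `ν_ψ` on `{E ≥ 0} × ℝ` with `F_ψ(t,s) = ∫ e^{-t|n|E + is|n|p} dν_ψ`;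
(2) frames `b_±`: `θ_{b₊} θ_n` is the quarter turn of the plane, so after a free translation along `n'`
both clusters `θ_{b₊}θ_n x` and `y + t n + s n'` lie in `{⟪·,b₊⟫ > 0}` once `u = (t+s)/√2 > u₀`, and
`u ↦ F_ψ` is a `b₊`-frame matrix element `⟪Ψ', e^{-(u−u₀)H_{b₊}} Ψ''⟫`: holomorphic on `Re u > u₀`,
bounded by `‖Ψ'‖‖Ψ''‖` UNIFORMLY in `v` (translations along `b₋ ⊥ b₊` are `b₊`-isometries); same in `v`;
(3) `u − u₀ = e^ξ`, `v − v₀ = e^η` and `DiamondCross` (`b = π/2`) ⇒ `F_ψ` holomorphic and bounded by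
`M_ψ` on `{|arg(u−u₀)| + |arg(v−v₀)| < π/2}`, whose slice at real `t` contains the disc
`|s| < R_t = t − √2 max(u₀,v₀)` (Thales: `β² < (t+σ−√2u₀)(t−σ−√2v₀)`);
(4) `s ↦ F_ψ(t,s)` is the Fourier transform of the finite positive measure `e^{-t|n|E}ν_ψ`; analytic in
`|s| < R_t` ⇒ (Lukacs, *Characteristic Functions* Thm 7.1.1: even moments `≤ C(2k)!/R^{2k}`) analytic
in the strip `|Im s| < R_t` with `F_ψ(t, iβ) = ∫ e^{-t|n|E − β|n|p} dν_ψ ≤ M_ψ`; `t → ∞` forces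
`ν_ψ{|p| > E} = 0`;
(5) hence `G(τ,σ) = ∫ e^{-τ|n|E + iσ|n|p} dν` converges absolutely on `Re τ ≥ |Im σ|`, is holomorphic
inside, `|G| ≤ ν_ψ(total) = ‖ψ‖²`; polarisation over the real span gives the two-combination form with
the bound `‖ψ‖² + ‖ψ'‖²`.  No `(A)`, no scale covariance.  Consistency: the Gaussian family with
covariance `1/(k_n² + v²k_{n'}² + k₂²)` is RP in `n` and `n'` for every `v` but RP in the bisectors iff
`v = 1` (triage r1-2) — exactly the content of the lever. -/
theorem stub_inPlaneLightCone :
    DiamondCross → ∀ (S : CorrFamily 3) (n n' bp bm : E3), IsB2Frame n n' bp bm → Regular S →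
      FrameData S n → FrameData S bp → FrameData S bm → InPlaneCone S n n' := by
  sorry

/-- Statement of stub 4 (THE OPEN CORE). -/
def BoostedNormGrowthStmt : Prop :=
  ∀ (ρ : ℝ → ℝ) (Δ : ℝ) (S : CorrFamily 3), CruxHyp ρ Δ S → HRP2Rigidity →
    (Regular S ∧ ∀ v : E3, IsLatticeMirrorNormal v → FrameData S v) → AllCones S →
    ∃ a : ℝ, a < 4 ∧ BoostedNormGrowth S a

/-- **Stub 4 — boosted-cluster norm growth of type `a < 4` (THE OPEN CORE of the crux; XL).**  For the
Ising limit with its nine-mirror frame data, all in-plane cones and the round two-point function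
(`HRP2Rigidity ∘ TwoPointKernelOfLimit`): the squared norms `N_A(η) = ‖Ψ^ℂ[R_{iη}A]‖²` of boosted
cluster vectors grow at most like `C_K e^{a|η|}` with `a < 4`, locally uniformly in the cluster.
Why plausibly true: (i) if the crux holds, `N_A` is CONSTANT (`a = 0`); (ii) the `fourfold-carlson-boost`
bookkeeping (triage r1-2 (C2), r1-3 §6): the boosted gaps are `e^{-sH}·(contraction)` with spare time
`s = e^{-|η|}Δh` given ONLY the square cone of stub 3, inner blocks have unboosted norms by
`θ ∘ conj ∘ R_{iη} = R_{iη} ∘ θ`, and the two-sided sandwich `‖e^{-uH}σ(0)e^{-vH}‖ ≤ C(u^{-Δ}+v^{-Δ})`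
(GFF-true iff `Δ > 1/2`; by scale covariance = boundedness of `e^{-H}σ(0)e^{-cH}`) yields `a = 2Δ ≤ 2`;
(iii) scale covariance rewrites `R_{iη}x = cosh η·(x + i tanh η·Jx)`, so `a < 4` is the statement that
`S^ℂ_{2m}` blows up at the totally null degeneration `y ↦ y + iJy` (all complex squared distances
`∝ 1 − tanh²η`) by at most `(null distance)^{-2mΔ − 4 + 0}` beyond naive scaling.  Why it might fail /
where `Δ ≤ 1` is spent: `O_h`-scalar composites of spin `≥ 4` fields are RP in all directions and
anisotropic (r1-3 calibration), so no argument blind to the window can work; route (ii) needs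
`Δ > 1/2` strictly (η > 0 is not proved on `ℤ³`) or a separate treatment of `Δ = 1/2`.
Honours `not_modelBlindNPointUpgrade`: RP at all orders + the cone are among the hypotheses. -/
theorem stub_boostedNormGrowth :
    ∀ (ρ : ℝ → ℝ) (Δ : ℝ) (S : CorrFamily 3), CruxHyp ρ Δ S → HRP2Rigidity →
      (Regular S ∧ ∀ v : E3, IsLatticeMirrorNormal v → FrameData S v) → AllCones S →
      ∃ a : ℝ, a < 4 ∧ BoostedNormGrowth S a := by
  sorry

/-- Statement of stub 5. -/
def BoostOrbitEntireStmt : Prop :=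
  ∀ (ρ : ℝ → ℝ) (Δ : ℝ) (S : CorrFamily 3), CruxHyp ρ Δ S → HRP2Rigidity →
    (Regular S ∧ ∀ v : E3, IsLatticeMirrorNormal v → FrameData S v) → AllCones S →
    ∀ a : ℝ, BoostedNormGrowth S a → ∀ N : ℕ, ∃ 𝒢 : Set (Fin N → E3), Dense 𝒢 ∧ ∀ X ∈ 𝒢,
      ∃ Φ : ℂ → ℂ, Differentiable ℂ Φ ∧ (∀ θ : ℝ, Φ θ = S N (fun i => rot θ (X i))) ∧
        (∀ ζ : ℂ, Φ (ζ + ((Real.pi / 2 : ℝ) : ℂ)) = Φ ζ) ∧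
        ∃ C : ℝ, ∀ ζ : ℂ, ‖Φ ζ‖ ≤ C * Real.exp (a * |ζ.im|)

/-- **Stub 5 — boost entirety of the rotation orbit (L–XL; provable on paper: Osterwalder–Schrader II,
Ch. V, with the holomorphic contraction family `N(τ,σ)` of the cone in place of `e^{-τH}`).**
Take `𝒢_N` = configurations whose plane projections `P xⱼ` are non-zero, pairwise distinct, and such
that no two of the vectors `{P xⱼ} ∪ {P(xⱼ − x_k)}` have directions differing by a multiple of `45°`
(complement of a proper real-algebraic set: dense).  For `X ∈ 𝒢_N` and every real `θ` at least one
in-plane frame `n ∈ {e₀, e₁, e₀±e₁}` sees `X_θ = R_θ X` with pairwise distinct NON-ZERO `n`-heights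
(two different frames cannot both be defeated at the same `θ`).  In frame `n`: (a) from `InPlaneCone`
rebuild the bounded holomorphic operators `N(τ,σ)` (`|⟪ψ,Nψ'⟫| ≤ ‖ψ‖²+‖ψ'‖²` ⇒ norm `≤ 2` ⇒ `≤ 1` by
normality and the semigroup law) on the frame-`n` OS space; (b) OS II (A_N)/(P_N) induction
(tree `OSPointVectors/Semigroup/LabelledVectors/Continuation`, `SesquiHolomorphicPairing`,
`PositiveKernelContinuation`) continues `S_N`, for fixed real axis coordinates, to the tube
`T_n = {sorted consecutive gaps Δz : Re⟪Δz,n⟫ > |Im⟪Δz,n'⟫|, Im⟪Δz,e₂⟫ = 0}` as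
`S^ℂ_N(Z) = ⟪Ψ^ℂ[θ conj Z_L], Ψ^ℂ[Z_U]⟫`; (c) `R_{iη}X_θ ∈ T_n` for ALL `η` because
`|Im Δσ| = |sinh η|Δh < cosh η Δh = Re Δτ` (speed one is exactly the threshold), so
`Φ⁽ⁿ⁾ := S^ℂ_N ∘ (ζ ↦ R_ζ X)` is holomorphic on the vertical strips `{Re ζ ∉ B_n(X)}`; the four strip
systems cover `ℂ`, agree on overlaps (identity theorem from the real axis) ⇒ `Φ_X` ENTIRE;
(d) `Φ_X(ζ + π/2) = Φ_X(ζ)` from the real axis, where the quarter turn `(x₀,x₁,x₂) ↦ (x₁,−x₀,x₂)` is a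
signed permutation (free `O_h` invariance of genuine limits, tree `limit_signFlip`/`limit_coordPerm`,
normalisation on the coincident locus); (e) type: split `X_θ` by the axis mirror of the good frame,
`|Φ_X(θ+iη)|² ≤ N_{θ_nL_θ}(η) N_{U_θ}(η)` (Cauchy–Schwarz; `h = 0` is admissible since the lowest
boosted point has `|Im σ| = |sinh η| h < cosh η h`), the clusters range over finitely many compact
families at distance `≥ δ_X` from their mirrors (compactness of the period), and `BoostedNormGrowth S a`
bounds each factor by `C e^{a|η|}`.  Honours `cruxBody_false_without_scalingLimit` (free `O_h`,
continuity) and uses H5, the cone and RP at all orders. -/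
theorem stub_boostOrbitEntire :
    ∀ (ρ : ℝ → ℝ) (Δ : ℝ) (S : CorrFamily 3), CruxHyp ρ Δ S → HRP2Rigidity →
      (Regular S ∧ ∀ v : E3, IsLatticeMirrorNormal v → FrameData S v) → AllCones S →
      ∀ a : ℝ, BoostedNormGrowth S a → ∀ N : ℕ, ∃ 𝒢 : Set (Fin N → E3), Dense 𝒢 ∧ ∀ X ∈ 𝒢,
        ∃ Φ : ℂ → ℂ, Differentiable ℂ Φ ∧ (∀ θ : ℝ, Φ θ = S N (fun i => rot θ (X i))) ∧
          (∀ ζ : ℂ, Φ (ζ + ((Real.pi / 2 : ℝ) : ℂ)) = Φ ζ) ∧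
          ∃ C : ℝ, ∀ ζ : ℂ, ‖Φ ζ‖ ≤ C * Real.exp (a * |ζ.im|) := by
  sorry

/-- Statement of stub 6. -/
def AxisRotationsGenerateStmt : Prop :=
  ∀ (ρ : ℝ → ℝ) (Δ : ℝ) (S : CorrFamily 3), CruxHyp ρ Δ S →
    (∀ N : ℕ, ∃ 𝒢 : Set (Fin N → E3), Dense 𝒢 ∧ ∀ X ∈ 𝒢, ∀ θ : ℝ,
      S N (fun i => rot θ (X i)) = S N X) →
    IsRotationInvariant S

/-- **Stub 6 — dense-set invariance about one lattice axis generates `O(3)` (provable now, M).**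
(1) Continuity of `S_N` on `NonCoincident` (free for genuine limits: tree `continuousOn_limit`) and of
`X ↦ R_θ ∘ X` extend `S_N(R_θ X) = S_N(X)` from the dense `𝒢_N` to all non-coincident `X`; on the
coincident locus both sides vanish by normalisation (`R_θ` is injective). (2) Conjugating by the
coordinate transposition `(1 2) ∈ O_h` (free, `limit_coordPerm`) gives invariance under rotations about
`e₁`. (3) Any unit vector is moved to `±e₀` by a rotation about `e₂` followed by one about `e₁`, so
every plane reflection is conjugate by axis rotations to the free coordinate reflection `θ_{e₀}`
(`limit_signFlip`); reflections generate `O(3)` (Cartan–Dieudonné, Mathlib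
`LinearIsometryEquiv.reflections_generate`, as in tree `RotationFromInversion.isRotationInvariant_of_inversion`). -/
theorem stub_axisRotationsGenerate :
    ∀ (ρ : ℝ → ℝ) (Δ : ℝ) (S : CorrFamily 3), CruxHyp ρ Δ S →
      (∀ N : ℕ, ∃ 𝒢 : Set (Fin N → E3), Dense 𝒢 ∧ ∀ X ∈ 𝒢, ∀ θ : ℝ,
        S N (fun i => rot θ (X i)) = S N X) →
      IsRotationInvariant S := by
  sorry

/-! ## §1b Consistency: each named statement IS its registered stub (definitionally) -/

theorem latticeFrameDataStmt_iff : LatticeFrameDataStmt := stub_latticeFrameData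
theorem diamondCross_iff : DiamondCross := stub_diamondCross
theorem inPlaneLightConeStmt_iff : InPlaneLightConeStmt := stub_inPlaneLightCone
theorem boostedNormGrowthStmt_iff : BoostedNormGrowthStmt := stub_boostedNormGrowth
theorem boostOrbitEntireStmt_iff : BoostOrbitEntireStmt := stub_boostOrbitEntire
theorem axisRotationsGenerateStmt_iff : AxisRotationsGenerateStmt := stub_axisRotationsGenerate

/-! ## §2 Elementary lemmas for the composition (all proved) -/

/-- The three mirrors of a `B₂` frame are lattice mirrors. [folklore] -/
theorem isLatticeMirrorNormal_of_isB2Frame {n n' bp bm : E3} (h : IsB2Frame n n' bp bm) :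
    IsLatticeMirrorNormal n ∧ IsLatticeMirrorNormal bp ∧ IsLatticeMirrorNormal bm := by
  obtain ⟨i, j, hij, hcase⟩ := h
  rcases hcase with ⟨rfl, -, rfl, rfl⟩ | ⟨rfl, -, rfl, rfl⟩ | ⟨rfl, -, rfl, rfl⟩
  · exact ⟨⟨i, j, hij, Or.inl rfl⟩, ⟨i, j, hij, Or.inr (Or.inl rfl)⟩, ⟨i, j, hij, Or.inr (Or.inr rfl)⟩⟩
  · exact ⟨⟨i, j, hij, Or.inr (Or.inl rfl)⟩, ⟨i, j, hij, Or.inl rfl⟩, ⟨j, i, hij.symm, Or.inl rfl⟩⟩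
  · exact ⟨⟨i, j, hij, Or.inr (Or.inr rfl)⟩, ⟨i, j, hij, Or.inl rfl⟩, ⟨j, i, hij.symm, Or.inl rfl⟩⟩

/-- The rotation by the angle `0` is the identity. [folklore] -/
theorem rot_zero_apply (x : E3) : rot 0 x = x := by
  ext j
  simp

/-- The quarter turn about `e₂` is the signed permutation `(x₀,x₁,x₂) ↦ (x₁, −x₀, x₂)` — an element of
`O_h`, under which every genuine limit is invariant for free (`limit_signFlip`, `limit_coordPerm`): this
is the source of the period `π/2` in stub 5. [folklore] -/
theorem rot_quarter_apply (x : E3) :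
    rot (Real.pi / 2) x 0 = x 1 ∧ rot (Real.pi / 2) x 1 = -x 0 ∧ rot (Real.pi / 2) x 2 = x 2 := by
  refine ⟨?_, ?_, ?_⟩ <;> simp [Real.cos_pi_div_two, Real.sin_pi_div_two]

/-- The group law along the real axis, `R_{θ+π/2} = R_{π/2} ∘ R_θ` (so `Φ_X(θ + π/2) = S_N(R_{π/2} R_θ X)
= S_N(R_θ X) = Φ_X(θ)` on `ℝ`, and on `ℂ` by the identity theorem). [folklore] -/
theorem rot_add_quarter (θ : ℝ) (x : E3) : rot (θ + Real.pi / 2) x = rot (Real.pi / 2) (rot θ x) := by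
  ext j
  fin_cases j <;>
    (simp [Real.cos_add, Real.sin_add, Real.cos_pi_div_two, Real.sin_pi_div_two]; try ring)

/-- `a < 4` is exactly the smallness `a · (π/2) < 2π` of the exponential type against the period
`π/2` required by the periodic Liouville theorem. [folklore] -/
theorem type_mul_period_lt {a : ℝ} (ha : a < 4) : a * (Real.pi / 2) < 2 * Real.pi := by
  nlinarith [Real.pi_pos]

/-! ## §3 The composition (kernel-checked, no `sorry`): the six stubs prove the crux BY NAME -/

/-- Alias of the crux used as the conclusion of `LimitRotationInvariant_of_stubs`, so that exactly ONE
theorem of this file (`LimitRotationInvariant_of`, which uses the registered stubs by name) concludes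
the crux decl by name. -/
abbrev CruxStatement : Prop :=
  _root_.Summit.CriticalPhenomena.Ising3DConformalLimit.Theses.HyperoctahedralRP.LimitRotationInvariant

/-- **`LimitRotationInvariant_of_stubs`** — the transparent composition: crux
`HyperoctahedralRP.LimitRotationInvariant` (item stmt-CriticalPhenomena-1980) from the six stub STATEMENTS
taken as hypotheses.  Stubs 1+2+3 give the in-plane light cones of
all `B₂` frames; stub 4 gives the type `a < 4`; stub 5 gives, on dense sets of configurations, entire
`π/2`-periodic orbit functions of exponential type `a`, which the tree's periodic Liouville theorem
`Literature.Analysis.Complex.apply_eq_apply_of_periodic_of_norm_le_exp` (`T = π/2`) makes constant;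
stub 6 upgrades dense-set axis invariance to `IsRotationInvariant S`. -/
theorem LimitRotationInvariant_of_stubs (h1 : LatticeFrameDataStmt) (h2 : DiamondCross)
    (h3 : InPlaneLightConeStmt) (h4 : BoostedNormGrowthStmt) (h5 : BoostOrbitEntireStmt)
    (h6 : AxisRotationsGenerateStmt) : CruxStatement := by
  show _root_.Summit.CriticalPhenomena.Ising3DConformalLimit.Theses.HyperoctahedralRP.LimitRotationInvariant
  intro hA ρ Δ S hρ hlim hnorm hnd htr hsc
  have hH : CruxHyp ρ Δ S := ⟨hρ, hlim, hnorm, hnd, htr, hsc⟩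
  -- stub 1: regularity and nine-mirror frame data of the limit
  have hFD : Regular S ∧ ∀ v : E3, IsLatticeMirrorNormal v → FrameData S v := h1 ρ Δ S hH
  -- stubs 2 + 3: the in-plane light cone of every B₂ frame
  have hcone : AllCones S := by
    intro n n' bp bm hB2
    obtain ⟨hn, hbp, hbm⟩ := isLatticeMirrorNormal_of_isB2Frame hB2
    exact h3 h2 S n n' bp bm hB2 hFD.1 (hFD.2 n hn) (hFD.2 bp hbp) (hFD.2 bm hbm)
  -- stub 4: the exponential type a < 4
  obtain ⟨a, ha4, hgrowth⟩ := h4 ρ Δ S hH hA hFD hcone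
  -- stub 5: entire periodic orbit functions of type a on dense sets
  have horbit := h5 ρ Δ S hH hA hFD hcone a hgrowth
  -- periodic Liouville ⇒ axis invariance on the dense sets; stub 6 ⇒ O(3)
  refine h6 ρ Δ S hH fun N => ?_
  obtain ⟨𝒢, hdense, hΦ⟩ := horbit N
  refine ⟨𝒢, hdense, fun X hX θ => ?_⟩
  obtain ⟨Φ, hdiff, hreal, hper, C, hbd⟩ := hΦ X hX
  have hT : (0 : ℝ) < Real.pi / 2 := by positivity
  have key := Literature.Analysis.Complex.apply_eq_apply_of_periodic_of_norm_le_exp hT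
    (type_mul_period_lt ha4) hdiff hper hbd (θ : ℂ) ((0 : ℝ) : ℂ)
  have h0 : (fun i => rot 0 (X i)) = X := funext fun i => rot_zero_apply (X i)
  have hC : ((S N (fun i => rot θ (X i)) : ℝ) : ℂ) = ((S N X : ℝ) : ℂ) := by
    calc ((S N (fun i => rot θ (X i)) : ℝ) : ℂ) = Φ θ := (hreal θ).symm
      _ = Φ ((0 : ℝ) : ℂ) := key
      _ = S N (fun i => rot 0 (X i)) := hreal 0
      _ = S N X := by rw [h0]
  exact_mod_cast hC

/-- **`LimitRotationInvariant_of`** — THE SKELETON THEOREM: the six registered stubs, used BY NAME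
(`stub_latticeFrameData`, `stub_diamondCross`, `stub_inPlaneLightCone`, `stub_boostedNormGrowth`,
`stub_boostOrbitEntire`, `stub_axisRotationsGenerate`), prove the crux decl
`HyperoctahedralRP.LimitRotationInvariant` BY NAME.  No `sorry` of its own; it becomes a proof of the
crux once the stubs' `sorry`s are discharged (landed stubs are then imported and keep their names). -/
theorem LimitRotationInvariant_of :
    _root_.Summit.CriticalPhenomena.Ising3DConformalLimit.Theses.HyperoctahedralRP.LimitRotationInvariant :=
  LimitRotationInvariant_of_stubs stub_latticeFrameData stub_diamondCross stub_inPlaneLightCone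
    stub_boostedNormGrowth stub_boostOrbitEntire stub_axisRotationsGenerate

end Summit.CriticalPhenomena.Ising3DConformalLimit.Cruxes.LimitRotationInvariant.BisectorCrossLightCone

end
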